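import Summits.QuantumFields.BalabanUV.Beta.FP.KernelPeriodisationFibLoc

/-!
# `BalabanUV.Beta.FP.TorusCompanionCorePeriodic` — road «FP» for binder row D1, ROUTE T (β1), J-RISK-3′ «THE PACKING AT THE PASS», SPEC-48 (B2):
# **A STOREY PRESCRIPTION `w • Σ_ā hb ā • (perF T (dper T 𝒱_ā))|ff` IS THE PERIODISATION OF ONE LATTICE CORE `𝒢 := (w · Σ_ā hb ā · 𝒱_ā)^{ff}`, AND THAT CORE
# CARRIES THE PACKING ENGINE's TWO SUMMABILITY LETTERS — from the two letters of each brick (or from its bi-localisation)**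

WHY.  The END wrapper's pin `hH₁f` displays, per storey `k` and direction `v`, leaf-05's Λ-companion
`F_v k := w k • Σ_ā hb k v ā • (perF T_k (dper T_k (SLam N (cf k) (symHessFFAt ρ_c Lc) ā.2 ā.1)))|ff` — a FINITE torus-indexed combination of periodised bricks.
The one-storey packing at the named rows (`TorusCompositeRowsSymSandwich`, g36) and the storey sum (`TorusCompanionSumPeriodic`, g36) consume, per storey, ONE lattice
core `𝒢_k : MKer (d+1) (Fin (d+1))` with `perF T_k (dper T_k 𝒢_k) = F_v k` and the engine's two pointwise summability letters (`hGd`: diagonal `T_k`-translates,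
`hGp`: `T_k`-translates of `dper T_k 𝒢_k`).  THIS FILE names that core generically — for ANY finite index type `ι`, weights `h : ι → ℝ`, scale `w` and bricks
`𝒱 : ι → MKer (d+1) (Fib d)` — and derives its two letters from the SAME two letters of each brick's `ff` part, or from each brick's bi-localisation
(`KernelPeriodisationFibLoc.summable_dper ∕ decays_dper` + `KernelPeriodisationFib.summable_translate_of_decays`) — the shape an2's `InterLevelTransport.locStencil_SLam`
delivers for the Λ-bricks from a decay letter on `cf`.

WHAT ([folklore] `tsum` linearity over finite sums BY NAME; no `def`, no `def … : Prop`, nothing cited, 0 sorry; the core is DISPLAYED as the lambda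
`fun x y a b => w * Σ_i h i * 𝒱 i x y (inl a) (inl b)`, no name minted):
* §1 `dper_core_apply`, `perZ_dper_core_apply` (entrywise), **`perF_dper_core`** (matrix form: `perF T (dper T 𝒢) = w • Σ_i h i • (perF T (dper T (𝒱 i)))|ff`,
  the `|ff` block being the wrapper's `submatrix (·, inl ·) (·, inl ·)` spelling) — under the bricks' letters `hSd ∕ hSp` at the `ff` fibres.
* §2 THE ENGINE's LETTERS OF THE CORE: `summable_core_diag` (`hGd`), `summable_core_right` (`hGp`).
* §3 THE BI-LOCALISED CASE: `summable_ff_diag_of_biLoc`, `summable_ff_right_of_biLoc` — the two brick letters from `BiLoc (𝒱 i) (p i) (q i) (C i) δ`, `0 < δ`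
  (an2's `LocStencil` currency, brick by brick), uniformly usable in §1–§2.
WHAT THIS IS NOT: not the identification of the bricks with the Λ-sector tables, not the discharge of `LocStencil (SLam …)` from the wrapper's `cf` (its displayed `hcf`
is a summability letter; the bi-localisation wants an2's decay letter on `cf` — the row's word); no row of the END wrapper discharged; no estimate; nothing of
Bałaban's asserted, valued or discharged; 0∕4 row-D1 binders (hW, hR, D1Tel, D1Rep); NOT (C1), NOT (T-ID), NOT SDF, NOT D1, NOT BetaPertH, NOT continuum, NOT Clay.

HONEST DEPENDENCY (page 1, mandatory): continuum YM on T⁴ ⇐ BetaPertH ∧ nine spine estimates (0/9 proved); BetaPertH ⇐ (D1) ∧ (D4) ∧ CAP+tail;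
G-an2-4 gates asym, D1 and NE2/3/4.  HONEST FRAMING (cell contract, verbatim): «discharging `BetaPertH` makes Bałaban's UV stability UNCONDITIONAL —
a real constructive-QFT result; it is NOT the continuum limit and NOT the Clay problem.»  ABSOLUTE RULE (cell charter, verbatim): «No internally-minted
statement may enter as a cited fact. Every hypothesis is either kernel-proved in this package or a verbatim quotation of a PUBLISHED theorem with page
reference. The manuscript(s) under audit are NOT citable for their own disputed steps — they are the thing under adjudication; programme-internal
(2001/route/tribunal) claims are never citable.»  Road «FP» OWNER, b2b-balaban-beta-d1-p3 gen 36, 2026-08-25.  No existing file touched.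
-/

noncomputable section

open scoped BigOperators

namespace Summit.QuantumFields.BalabanUV.Beta.FP.TorusCompanionCorePeriodic

open Finset Matrix
open Literature.MathematicalPhysics.QuantumFieldTheory.Balaban1983to89
open Literature.MathematicalPhysics.QuantumFieldTheory.Balaban1983to89.Beta
open B4TorusKernel.MultiPeriod (translate)
open B4Sect5Proof (latticeConst latticeConst_nonneg)
open B6Lemma24Torus (pbox)
open ExpKernelCalculus (MKer BiLoc)
open OneStepResolventKernel (Fib)
open Summit.QuantumFields.BalabanUV.Beta.FP.KernelPeriodisationFib (Idx perF perF_apply perZ perZ_apply summable_translate_of_decays)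
open Summit.QuantumFields.BalabanUV.Beta.FP.KernelPeriodisationFibLoc (dper dper_apply summable_dper decays_dper)

variable {d : ℕ} (T : Fin (d + 1) → ℕ) {ι : Type*} [Fintype ι]

/-! ## §1 The core of a storey prescription, periodised -/

section Core

variable (w : ℝ) (h : ι → ℝ) (𝒱 : ι → MKer (d + 1) (Fib d))

/-- [folklore] **`dper_core_apply`**: the diagonal periodisation of the core `fun x y a b => w * Σ_i h i * 𝒱 i x y (inl a) (inl b)` is `w * Σ_i h i *` the diagonal
periodisations of the bricks at the `ff` fibres (each brick's diagonal `T`-translates summable, `hSd`). -/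
theorem dper_core_apply
    (hSd : ∀ (i : ι) (x y : Fin (d + 1) → ℤ) (a b : Fin (d + 1)), Summable fun m₀ : Fin (d + 1) → ℤ => 𝒱 i (translate T x m₀) (translate T y m₀) (Sum.inl a) (Sum.inl b))
    (x y : Fin (d + 1) → ℤ) (a b : Fin (d + 1)) :
    dper T (fun x y (a b : Fin (d + 1)) => w * ∑ i, h i * 𝒱 i x y (Sum.inl a) (Sum.inl b)) x y a b
      = w * ∑ i, h i * dper T (𝒱 i) x y (Sum.inl a) (Sum.inl b) := by
  rw [dper_apply, tsum_mul_left]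
  congr 1
  rw [Summable.tsum_finsetSum fun i _ => (hSd i x y a b).mul_left (h i)]
  exact Finset.sum_congr rfl fun i _ => by rw [tsum_mul_left, dper_apply]

/-- [folklore] **`perZ_dper_core_apply`**: `perZ T (dper T 𝒢) x y a b = w * Σ_i h i * perZ T (dper T (𝒱 i)) x y (inl a) (inl b)` under the two brick letters. -/
theorem perZ_dper_core_apply
    (hSd : ∀ (i : ι) (x y : Fin (d + 1) → ℤ) (a b : Fin (d + 1)), Summable fun m₀ : Fin (d + 1) → ℤ => 𝒱 i (translate T x m₀) (translate T y m₀) (Sum.inl a) (Sum.inl b))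
    (hSp : ∀ (i : ι) (x y : Fin (d + 1) → ℤ) (a b : Fin (d + 1)), Summable fun m : Fin (d + 1) → ℤ => dper T (𝒱 i) x (translate T y m) (Sum.inl a) (Sum.inl b))
    (x y : Fin (d + 1) → ℤ) (a b : Fin (d + 1)) :
    perZ T (dper T (fun x y (a b : Fin (d + 1)) => w * ∑ i, h i * 𝒱 i x y (Sum.inl a) (Sum.inl b))) x y a b
      = w * ∑ i, h i * perZ T (dper T (𝒱 i)) x y (Sum.inl a) (Sum.inl b) := by
  rw [perZ_apply]
  simp_rw [dper_core_apply T w h 𝒱 hSd]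
  rw [tsum_mul_left]
  congr 1
  rw [Summable.tsum_finsetSum fun i _ => (hSp i x y a b).mul_left (h i)]
  exact Finset.sum_congr rfl fun i _ => by rw [tsum_mul_left, perZ_apply]

/-- [folklore] **`perF_dper_core` — THE STOREY PRESCRIPTION IS THE PERIODISATION OF ONE CORE**:
`perF T (dper T (fun x y a b => w * Σ_i h i * 𝒱 i x y (inl a) (inl b))) = w • Σ_i h i • (perF T (dper T (𝒱 i))).submatrix (·, inl ·) (·, inl ·)` — the `hH₁f` ∕ `F_v k`
spelling of the END wrapper (`ι := ↥(pbox T_k) × Fin (d+1)`, `h := hb k v`, `w := w k`, `𝒱 ā := SLam N (cf k) (symHessFFAt ρ_c Lc) ā.2 ā.1`). -/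
theorem perF_dper_core
    (hSd : ∀ (i : ι) (x y : Fin (d + 1) → ℤ) (a b : Fin (d + 1)), Summable fun m₀ : Fin (d + 1) → ℤ => 𝒱 i (translate T x m₀) (translate T y m₀) (Sum.inl a) (Sum.inl b))
    (hSp : ∀ (i : ι) (x y : Fin (d + 1) → ℤ) (a b : Fin (d + 1)), Summable fun m : Fin (d + 1) → ℤ => dper T (𝒱 i) x (translate T y m) (Sum.inl a) (Sum.inl b)) :
    perF T (dper T (fun x y (a b : Fin (d + 1)) => w * ∑ i, h i * 𝒱 i x y (Sum.inl a) (Sum.inl b)))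
      = w • ∑ i, h i • (perF T (dper T (𝒱 i))).submatrix
          (fun p : ↥(pbox T) × Fin (d + 1) => ((p.1, Sum.inl p.2) : Idx T (Fib d)))
          (fun p : ↥(pbox T) × Fin (d + 1) => ((p.1, Sum.inl p.2) : Idx T (Fib d))) := by
  ext p q
  rw [perF_apply, perZ_dper_core_apply T w h 𝒱 hSd hSp, Matrix.smul_apply, Matrix.sum_apply, smul_eq_mul]
  rfl

/-! ## §2 The engine's two letters of the core -/

/-- [folklore] **THE ENGINE's `hGd` OF THE CORE**: its diagonal `T`-translates are summable (finite sum of scalar multiples of the bricks' `hSd`). -/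
theorem summable_core_diag
    (hSd : ∀ (i : ι) (x y : Fin (d + 1) → ℤ) (a b : Fin (d + 1)), Summable fun m₀ : Fin (d + 1) → ℤ => 𝒱 i (translate T x m₀) (translate T y m₀) (Sum.inl a) (Sum.inl b))
    (x y : Fin (d + 1) → ℤ) (a b : Fin (d + 1)) :
    Summable fun m₀ : Fin (d + 1) → ℤ =>
      (fun x y (a b : Fin (d + 1)) => w * ∑ i, h i * 𝒱 i x y (Sum.inl a) (Sum.inl b)) (translate T x m₀) (translate T y m₀) a b :=
  (summable_sum fun i _ => (hSd i x y a b).mul_left (h i)).mul_left w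

/-- [folklore] **THE ENGINE's `hGp` OF THE CORE**: the `T`-translates of its diagonal periodisation are summable (`dper_core_apply` + the bricks' `hSp`). -/
theorem summable_core_right
    (hSd : ∀ (i : ι) (x y : Fin (d + 1) → ℤ) (a b : Fin (d + 1)), Summable fun m₀ : Fin (d + 1) → ℤ => 𝒱 i (translate T x m₀) (translate T y m₀) (Sum.inl a) (Sum.inl b))
    (hSp : ∀ (i : ι) (x y : Fin (d + 1) → ℤ) (a b : Fin (d + 1)), Summable fun m : Fin (d + 1) → ℤ => dper T (𝒱 i) x (translate T y m) (Sum.inl a) (Sum.inl b))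
    (x y : Fin (d + 1) → ℤ) (a b : Fin (d + 1)) :
    Summable fun m : Fin (d + 1) → ℤ =>
      dper T (fun x y (a b : Fin (d + 1)) => w * ∑ i, h i * 𝒱 i x y (Sum.inl a) (Sum.inl b)) x (translate T y m) a b := by
  simp_rw [dper_core_apply T w h 𝒱 hSd]
  exact (summable_sum fun i _ => (hSp i x y a b).mul_left (h i)).mul_left w

end Core

/-! ## §3 The bi-localised case: the two brick letters from `BiLoc` -/

section BiLocCase

variable [∀ μ, NeZero (T μ)] (𝒱 : ι → MKer (d + 1) (Fib d)) {p q : ι → (Fin (d + 1) → ℤ)} {C : ι → ℝ} {δ : ℝ}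

omit [Fintype ι] in
/-- [folklore] the `hSd` letter of a bi-localised brick at the `ff` fibres (`KernelPeriodisationFibLoc.summable_dper`). -/
theorem summable_ff_diag_of_biLoc (hV : ∀ i, BiLoc (𝒱 i) (p i) (q i) (C i) δ) (hC : ∀ i, 0 ≤ C i) (hδ : 0 < δ)
    (i : ι) (x y : Fin (d + 1) → ℤ) (a b : Fin (d + 1)) :
    Summable fun m₀ : Fin (d + 1) → ℤ => 𝒱 i (translate T x m₀) (translate T y m₀) (Sum.inl a) (Sum.inl b) :=
  summable_dper T (hV i) (hC i) hδ x y (Sum.inl a) (Sum.inl b)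

omit [Fintype ι] in
/-- [folklore] the `hSp` letter of a bi-localised brick at the `ff` fibres (`decays_dper` + `summable_translate_of_decays`). -/
theorem summable_ff_right_of_biLoc (hV : ∀ i, BiLoc (𝒱 i) (p i) (q i) (C i) δ) (hC : ∀ i, 0 ≤ C i) (hδ : 0 < δ)
    (i : ι) (x y : Fin (d + 1) → ℤ) (a b : Fin (d + 1)) :
    Summable fun m : Fin (d + 1) → ℤ => dper T (𝒱 i) x (translate T y m) (Sum.inl a) (Sum.inl b) :=
  summable_translate_of_decays (decays_dper T (hV i) (hC i) hδ)
    (mul_nonneg (mul_nonneg (hC i) (Real.exp_pos _).le) (latticeConst_nonneg (d + 1) (half_pos hδ).le)) (half_pos hδ)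
    (fun μ => Nat.one_le_iff_ne_zero.mpr (NeZero.ne (T μ))) x y (Sum.inl a) (Sum.inl b)

/-- [folklore] **`perF_dper_core_of_biLoc`** — §1's matrix identity for bi-localised bricks (`0 < δ`), letters discharged. -/
theorem perF_dper_core_of_biLoc (w : ℝ) (h : ι → ℝ) (hV : ∀ i, BiLoc (𝒱 i) (p i) (q i) (C i) δ) (hC : ∀ i, 0 ≤ C i) (hδ : 0 < δ) :
    perF T (dper T (fun x y (a b : Fin (d + 1)) => w * ∑ i, h i * 𝒱 i x y (Sum.inl a) (Sum.inl b)))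
      = w • ∑ i, h i • (perF T (dper T (𝒱 i))).submatrix
          (fun p : ↥(pbox T) × Fin (d + 1) => ((p.1, Sum.inl p.2) : Idx T (Fib d)))
          (fun p : ↥(pbox T) × Fin (d + 1) => ((p.1, Sum.inl p.2) : Idx T (Fib d))) :=
  perF_dper_core T w h 𝒱 (summable_ff_diag_of_biLoc T 𝒱 hV hC hδ) (summable_ff_right_of_biLoc T 𝒱 hV hC hδ)

end BiLocCase

end Summit.QuantumFields.BalabanUV.Beta.FP.TorusCompanionCorePeriodic

end
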